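import Literature.MathematicalPhysics.QuantumFieldTheory.Balaban1983to89.B7Prop3StaircaseStokesRec

/-!
# `Balaban1983to89.B7Prop4FlatCurlTransportRec` — THE FLAT CURL OF THE STRAIGHT BLOCK AVERAGE (125) IS A BLOCK MEAN OF FINE CURLS ([Balaban1985Averaging] (48)–(50) bookkeeping): «curl of
# `L·Q₀A` ≤ L²·max|A(∂p)|», and its iterate over the levels — the input of route (a) at [Balaban1985RegularSpaces] (1.56)–(1.57) for the record (NOTE-157, director-ym №266)

statement-level skeleton of published theorems with citation tags; proofs where landed; nothing here is a claim about the Yang–Mills mass gap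

CITATION HEADER (lean-in-tree rule).  Cell `pub-ymgap`, seat `pub-ymgap-dag-n05-e` g36 (N05-REC LEAD PEN); item R1 ([3] layer), road (A′): the flat companion of `B7Prop4CurlTransportRec` for
the LINEAR iterates `linQIterZ` (= the gauge-corrected iterate `Ŷ_j` at the flat background, `B7Prop3GaugeCarryRec.QhatZ_one_left`), whose plaquette curls feed the flat Stokes bound of the carried
letter (`B7Prop3StaircaseStokesRec.norm_PhiZ_le`) in the data step (1.56)–(1.57) of [6] for the record (desk `NOTE-157-RECORD-LINEAR-OPERATOR.md`).  `--kind proof --supports stmt-QuantumFields-20541`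
(K0⁷; count-neutral; no definition).  Sources READ: [3] = [Balaban1985Averaging] pp. 24–25 (47)–(50), p. 36 (125), p. 37 (127) (`paper:balaban1985-cmp98-averaging`); [6] = [Balaban1985RegularSpaces]
p. 86 (1.56)–(1.57).  REUSED BY NAME: `B7Prop3StaircaseStokesRec.asum_rectWord_eq ∕ norm_asum_rectWord_le` (flat Stokes on a rectangle, engine `B7Prop1Explicit.stokes`), `B7SectEFLinearisationRec.linQZ ∕
linQIterZ`, `B7Prop1Explicit.asum_plaqWord`.

WHAT IS PROVED (sorry-free).  ★`asum_plaqWord_linQZ_rescale` — the coarse plaquette sum of the rescaled straight average `(z, κ) ↦ L·(Q₀Y)(Lz, κ)` IS the block mean of the boundary sums of the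
translated `L × L` squares: `= Σ_r L^{−d}·Y(∂[Lz + o_r; L × L])` (the corner cancellation of (48) for the straight average); ★`norm_asum_plaqWord_linQZ_rescale_le` — hence `≤ L²·M` for a global
fine plaquette bound `M`; ★★`norm_curl_linQIterZ_le` — over the levels, `‖(linQIterZ L B j)(∂P)‖ ≤ L^{2j}·M` for every coarse plaquette `P` (`M` a global bound of `‖B(∂p)‖`).
HONEST SCOPE.  Flat abelian-linear bookkeeping with global plaquette bounds (local versions follow the same proof with the rectangle-locality of `B7Prop3StaircaseStokesRec`); nothing of [3]∕[6]
asserted; `HThm4Rec` UNDISCHARGED; N05 discharged of record untouched; N07 not claimable; counts unmoved (typed 28∕28 · discharged 8∕28); one finite 𝕋⁴ programme at fixed ε — nothing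
continuum ∕ ℝ⁴ ∕ OS ∕ mass gap ∕ Clay.  No `def`, no `instance`, no `notation`, no `sorry`.
-/

set_option autoImplicit false

noncomputable section

open scoped BigOperators
open Finset

namespace Literature.MathematicalPhysics.QuantumFieldTheory.Balaban1983to89.B7Prop4FlatCurlTransportRec

open B7Prop1Explicit hiding Site
open B7Prop1Explicit renaming Site → SiteZ
open BlockAveragingZd (offZ)
open B7SectEFLinearisationRec (linQZ linQIterZ linQIterZ_zero linQIterZ_succ)
open B7Prop3StaircaseStokesRec (asum_rectWord_eq norm_asum_rectWord_le)

variable {d : ℕ}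

variable {𝔸 : Type*} [NormedRing 𝔸] [NormedAlgebra ℂ 𝔸] (L : ℕ)

/-- ★ **THE COARSE PLAQUETTE OF THE STRAIGHT AVERAGE IS A BLOCK MEAN OF SQUARE BOUNDARIES**: for the rescaled flat linear part `F(z, κ) = L·(Q₀Y)(⟨Lz, Lz + Le_κ⟩) = Σ_r L^{−d} Y([Lz + o_r, Lz + o_r + Le_κ])`,
`F(∂P_{z;μν}) = Σ_r L^{−d}·Y(∂[Lz + o_r; Le_μ × Le_ν])` — the four straight runs of the four bonds of the coarse plaquette, translated by the same offset `o_r`, close up into the boundary of an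
`L × L` square ((48)'s corner cancellation for the straight average). [cite: Balaban1985Averaging, (48) p.25, (125) p.36] -/
theorem asum_plaqWord_linQZ_rescale (Y : SiteZ d → Fin d → 𝔸) (z : SiteZ d) (μ ν : Fin d) :
    asum (fun w κ => linQZ L Y ((L : ℤ) • w) κ) z (plaqWord μ ν)
      = ∑ r : Fin d → Fin L, (((L : ℝ) ^ d)⁻¹) • asum Y ((L : ℤ) • z + offZ L r) (rectWord L L μ ν) := by
  rw [asum_plaqWord]
  simp only [linQZ]
  rw [← Finset.sum_add_distrib, ← Finset.sum_sub_distrib, ← Finset.sum_sub_distrib]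
  refine Finset.sum_congr rfl fun r _ => ?_
  have h1 : (L : ℤ) • (z + e μ) + offZ L r = (L : ℤ) • z + offZ L r + ((L : ℕ) : ℤ) • e μ := by rw [smul_add]; abel
  have h2 : (L : ℤ) • (z + e ν) + offZ L r = (L : ℤ) • z + offZ L r + ((L : ℕ) : ℤ) • e ν := by rw [smul_add]; abel
  rw [h1, h2, asum_rectWord_eq, smul_sub, smul_sub, smul_add]

/-- ★ **`‖F(∂P)‖ ≤ L²·M`** for the rescaled straight average `F = L·Q₀Y` and a global bound `M` of the fine plaquette curls `‖Y(∂p)‖` (`L ≥ 1`): each translated square has `L²` plaquettes.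
[cite: Balaban1985Averaging, (48)–(50) pp.24–25, (125) p.36] -/
theorem norm_asum_plaqWord_linQZ_rescale_le (hL : 1 ≤ L) (Y : SiteZ d → Fin d → 𝔸) {M : ℝ} (hM : ∀ (x : SiteZ d) (μ ν : Fin d), ‖asum Y x (plaqWord μ ν)‖ ≤ M)
    (z : SiteZ d) (μ ν : Fin d) :
    ‖asum (fun w κ => linQZ L Y ((L : ℤ) • w) κ) z (plaqWord μ ν)‖ ≤ (L : ℝ) ^ 2 * M := by
  rw [asum_plaqWord_linQZ_rescale]
  have hterm : ∀ r : Fin d → Fin L, ‖asum Y ((L : ℤ) • z + offZ L r) (rectWord L L μ ν)‖ ≤ (L : ℝ) ^ 2 * M := fun r => by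
    have h := norm_asum_rectWord_le Y ((L : ℤ) • z + offZ L r) (2 * L) (fun x μ' ν' _ => hM x μ' ν') ((L : ℤ) • z + offZ L r) L L μ ν
      (fun i hi j hj => by
        have e1 : (L : ℤ) • z + offZ L r + (i : ℤ) • e μ + (j : ℤ) • e ν - ((L : ℤ) • z + offZ L r) = (i : ℤ) • e μ + (j : ℤ) • e ν := by abel
        rw [e1]
        calc l1 ((i : ℤ) • e μ + (j : ℤ) • e ν) ≤ l1 ((i : ℤ) • e μ) + l1 ((j : ℤ) • e ν) := l1_add_le _ _
          _ = i + j := by rw [l1_zsmul_e, l1_zsmul_e]; simp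
          _ ≤ 2 * L := by omega)
    calc ‖asum Y ((L : ℤ) • z + offZ L r) (rectWord L L μ ν)‖ ≤ (L : ℝ) * L * M := h
      _ = (L : ℝ) ^ 2 * M := by ring
  calc ‖∑ r : Fin d → Fin L, (((L : ℝ) ^ d)⁻¹) • asum Y ((L : ℤ) • z + offZ L r) (rectWord L L μ ν)‖
      ≤ ∑ r : Fin d → Fin L, ‖(((L : ℝ) ^ d)⁻¹) • asum Y ((L : ℤ) • z + offZ L r) (rectWord L L μ ν)‖ := norm_sum_le _ _
    _ ≤ ∑ _r : Fin d → Fin L, (((L : ℝ) ^ d)⁻¹) * ((L : ℝ) ^ 2 * M) := Finset.sum_le_sum fun r _ => by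
        rw [norm_smul, Real.norm_of_nonneg (by positivity)]
        exact mul_le_mul_of_nonneg_left (hterm r) (by positivity)
    _ = (L : ℝ) ^ 2 * M := by
        rw [Finset.sum_const, Finset.card_univ, nsmul_eq_mul, Fintype.card_fun, Fintype.card_fin, Fintype.card_fin]
        have hL0 : (L : ℝ) ≠ 0 := by exact_mod_cast (by omega : L ≠ 0)
        push_cast
        field_simp

/-- ★★ **OVER THE LEVELS: `‖(linQIterZ L B j)(∂P)‖ ≤ L^{2j}·M`** for every coarse plaquette `P`, `M` a global bound of the fine plaquette curls `‖B(∂p)‖` — the flat curls of the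
`Q̂`-iterates (`= linQIterZ` at the flat background) that bound the carried letter `Θ_j = Σ Φ(Ŷ_i)` in route (a) of NOTE-157 (‖Φ(Ŷ_i)‖ ≤ (d·s)²·L^{2i}·M, `norm_PhiZ_le_global`).
[cite: Balaban1985Averaging, (127) p.37, (125) p.36, (48)–(50) pp.24–25; Balaban1985RegularSpaces, (1.56)–(1.57) p.86] -/
theorem norm_curl_linQIterZ_le (hL : 1 ≤ L) (B : SiteZ d → Fin d → 𝔸) {M : ℝ} (hM : ∀ (x : SiteZ d) (μ ν : Fin d), ‖asum B x (plaqWord μ ν)‖ ≤ M) :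
    ∀ (j : ℕ) (z : SiteZ d) (μ ν : Fin d), ‖asum (linQIterZ L B j) z (plaqWord μ ν)‖ ≤ ((L : ℝ) ^ 2) ^ j * M
  | 0, z, μ, ν => by simpa using hM z μ ν
  | j + 1, z, μ, ν => by
    have ih : ∀ (x : SiteZ d) (μ' ν' : Fin d), ‖asum (linQIterZ L B j) x (plaqWord μ' ν')‖ ≤ ((L : ℝ) ^ 2) ^ j * M := norm_curl_linQIterZ_le hL B hM j
    have h := norm_asum_plaqWord_linQZ_rescale_le L hL (linQIterZ L B j) ih z μ ν
    have e : (linQIterZ L B (j + 1)) = fun w κ => linQZ L (linQIterZ L B j) ((L : ℤ) • w) κ := rfl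
    rw [e]
    calc ‖asum (fun w κ => linQZ L (linQIterZ L B j) ((L : ℤ) • w) κ) z (plaqWord μ ν)‖ ≤ (L : ℝ) ^ 2 * (((L : ℝ) ^ 2) ^ j * M) := h
      _ = ((L : ℝ) ^ 2) ^ (j + 1) * M := by ring

end Literature.MathematicalPhysics.QuantumFieldTheory.Balaban1983to89.B7Prop4FlatCurlTransportRec
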